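import Summits.ResolutionOfSingularities.ResolutionOfSingularities.Theses.UniversalCells

/-!
# Crux `Universality` (stmt-ResolutionOfSingularities-15234) — the hypothesis `LocallyOfFiniteType f` is load-bearing

Route `ResolutionOfSingularities/UniversalCells`, crux #7 `Universality` (Mnëv–Lafforgue–Lee–Vakil
universality, matrix form over the prime field). The crux is a THEOREM of the tree (line `birth`, stubs
p147700–p150447 compose to it), so no refutation exists; this file certifies that the finite-type
hypothesis carries weight: `universality_false_without_locallyOfFiniteType` proves that the crux with
the single hypothesis `AlgebraicGeometry.LocallyOfFiniteType f` DELETED (everything else verbatim) is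
FALSE.

Witness: `p = 2`, `Y = Spec 𝔽₂(t)` (`RatFunc (ZMod 2)`; affine — hence separated and quasi-compact over
`Spec 𝔽₂` — and integral), `y` its point. If `W ∋ w` were open in `𝔸ˢ_Y` (via `j`) and open in a partial
matroid stratum `Spec S` (via `i`; `S` is a finitely generated `𝔽₂`-algebra), take an affine open `V ∋ w`
of `W`: its coordinate ring `C = Γ(V)` is non-zero, receives a ring map from the field `𝔽₂(t)` (through
`j`), and is of finite type over `𝔽₂` (through the open immersion `V ⟶ Spec S` of affine schemes). But a
non-zero finitely generated `𝔽₂`-algebra has a residue field that is FINITE (Zariski's lemma over the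
Jacobson ring `𝔽₂`), and the infinite field `𝔽₂(t)` cannot map into a finite field
(`false_of_finiteType_of_ringHom_ratFunc`). Moral for provers/planners: finite type enters through the
finite generation of every affine chart (`stub_affinePresentation`); it cannot be weakened to
"integral + separated + quasi-compact". No definitions, no facts; kernel-only (cdisprove seat
refuter-cdisprove-stmt-ResolutionOfSingularities-15234-0, 2026-08-17).
-/

noncomputable section

-- single-problem summit: the doubled namespace component `ResolutionOfSingularities` is forced
set_option linter.dupNamespace false

open CategoryTheory AlgebraicGeometry TopologicalSpace

namespace Summit.ResolutionOfSingularities.ResolutionOfSingularities.Theorems.Universality.Negative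

/-- A non-zero `𝔽₂`-algebra of finite type admits no ring map from `𝔽₂(t)`: modulo a maximal ideal it
is a field finitely generated over the Jacobson ring `𝔽₂`, hence a finite `𝔽₂`-module (Zariski's
lemma), hence a finite set, while a ring map out of the infinite field `𝔽₂(t)` is injective.
[folklore] -/
theorem false_of_finiteType_of_ringHom_ratFunc {C : Type} [CommRing C] [Nontrivial C]
    (ψ : ZMod 2 →+* C) (hψ : ψ.FiniteType) (φ : RatFunc (ZMod 2) →+* C) : False := by
  obtain ⟨M, hM⟩ := Ideal.exists_maximal C
  letI : Field (C ⧸ M) := Ideal.Quotient.field M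
  let ψ' : ZMod 2 →+* C ⧸ M := (Ideal.Quotient.mk M).comp ψ
  have hψ' : ψ'.FiniteType :=
    (RingHom.FiniteType.of_surjective _ Ideal.Quotient.mk_surjective).comp hψ
  letI : Algebra (ZMod 2) (C ⧸ M) := ψ'.toAlgebra
  haveI : Algebra.FiniteType (ZMod 2) (C ⧸ M) := hψ'
  haveI : Module.Finite (ZMod 2) (C ⧸ M) := finite_of_finite_type_of_isJacobsonRing (ZMod 2) (C ⧸ M)
  haveI : Finite (C ⧸ M) := Module.finite_of_finite (ZMod 2)
  haveI : Infinite (RatFunc (ZMod 2)) :=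
    Infinite.of_injective _ (IsFractionRing.injective (Polynomial (ZMod 2)) (RatFunc (ZMod 2)))
  haveI : Infinite (C ⧸ M) :=
    Infinite.of_injective _ ((Ideal.Quotient.mk M).comp φ).injective
  exact not_finite (C ⧸ M)

/-- The coordinate ring of an affine scheme with a point is non-zero. [folklore] -/
theorem nontrivial_Γ_of_isAffine (X : Scheme.{0}) [IsAffine X] (x : X) : Nontrivial Γ(X, ⊤) := by
  let q := X.isoSpec.hom.base x
  by_contra hC
  rw [not_nontrivial_iff_subsingleton] at hC
  exact q.isPrime.ne_top ((Ideal.eq_top_iff_one _).mpr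
    (by rw [Subsingleton.elim (1 : Γ(X, ⊤)) 0]; exact Ideal.zero_mem _))

/-- No scheme with a point is simultaneously open in affine space over `Spec 𝔽₂(t)` and open in the
spectrum of a finitely generated `𝔽₂`-algebra: an affine open around the point would have a non-zero
coordinate ring of finite type over `𝔽₂` receiving a ring map from `𝔽₂(t)`. [folklore] -/
theorem false_of_isOpenImmersion_affineSpace_ratFunc (s : ℕ) {W : Scheme.{0}}
    (j : W ⟶ 𝔸(Fin s; Spec (.of (RatFunc (ZMod 2))))) [IsOpenImmersion j]
    {S : Type} [CommRing S] [Algebra (ZMod 2) S] [Algebra.FiniteType (ZMod 2) S]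
    (i : W ⟶ Spec (.of S)) [IsOpenImmersion i] (w : W) : False := by
  let K : Type := RatFunc (ZMod 2)
  let A : CommRingCat.{0} := .of (MvPolynomial (Fin s) K)
  let e : 𝔸(Fin s; Spec (.of K)) ≅ Spec A := AffineSpace.SpecIso (Fin s) (.of K)
  let j' : W ⟶ Spec A := j ≫ e.hom
  -- an affine open `V ∋ w` of `W` and its coordinate ring `C`
  obtain ⟨V, hV, hwV, -⟩ : ∃ V : W.Opens, V ∈ W.affineOpens ∧ w ∈ V ∧ V ≤ ⊤ :=
    (Opens.isBasis_iff_nbhd.mp W.isBasis_affineOpens) (Opens.mem_top w)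
  haveI : IsAffine V := hV
  haveI : Nontrivial Γ(V, ⊤) := nontrivial_Γ_of_isAffine V ⟨w, hwV⟩
  -- `C` receives a ring map from `K = 𝔽₂(t)` through `j`
  let φ : K →+* Γ(V, ⊤) :=
    ((V.ι ≫ j').appTop).hom.comp
      ((Scheme.ΓSpecIso A).commRingCatIsoToRingEquiv.symm.toRingHom.comp
        (algebraMap K (MvPolynomial (Fin s) K)))
  -- `C` is of finite type over `𝔽₂` through the open immersion `V ⟶ Spec S` of affine schemes
  let g : (V : Scheme.{0}) ⟶ Spec (.of S) := V.ι ≫ i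
  have hg : LocallyOfFiniteType g := inferInstance
  have hgft : g.appTop.hom.FiniteType :=
    (HasRingHomProperty.iff_of_isAffine (P := @LocallyOfFiniteType)).mp hg
  have hS : (algebraMap (ZMod 2) S).FiniteType := RingHom.finiteType_algebraMap.mpr inferInstance
  let ψ : ZMod 2 →+* Γ(V, ⊤) :=
    g.appTop.hom.comp
      ((Scheme.ΓSpecIso (.of S)).commRingCatIsoToRingEquiv.symm.toRingHom.comp (algebraMap (ZMod 2) S))
  have hψ : ψ.FiniteType :=
    hgft.comp ((RingHom.FiniteType.of_surjective _
      (Scheme.ΓSpecIso (.of S)).commRingCatIsoToRingEquiv.symm.surjective).comp hS)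
  exact false_of_finiteType_of_ringHom_ratFunc ψ hψ φ

/-- **`LocallyOfFiniteType f` is load-bearing in `UniversalCells.Universality`.** The crux with the
single hypothesis `AlgebraicGeometry.LocallyOfFiniteType f` DELETED and nothing else changed (same
binders, same `let`-bound tautological matrix `[I₃ | A]`, minor ideal and partial stratum ring, same
conclusion) is FALSE. Witness: `p = 2`, `Y = Spec 𝔽₂(t)` (affine, hence separated and quasi-compact
over `Spec 𝔽₂`; integral), `y` its point; the partial stratum ring is a finitely generated
`𝔽₂`-algebra (localisation at one element of a quotient of a polynomial ring in `3m` variables), so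
`false_of_isOpenImmersion_affineSpace_ratFunc` applies. So every proof of the crux uses finite type
(it enters through the finite generation of affine charts). [folklore] -/
theorem universality_false_without_locallyOfFiniteType :
    ¬ (∀ p : ℕ, p.Prime → ∀ (Y : AlgebraicGeometry.Scheme.{0}) (f : Y ⟶ AlgebraicGeometry.Spec (.of (ZMod p))), AlgebraicGeometry.IsSeparated f → AlgebraicGeometry.QuasiCompact f → AlgebraicGeometry.IsIntegral Y → ∀ y : Y, ∃ (m : ℕ) (Γp : Finset (Fin 3 → Fin 3 ⊕ Fin m)) (Γ0 : Set (Fin 3 → Fin 3 ⊕ Fin m)) (s : ℕ) (W : AlgebraicGeometry.Scheme.{0}) (j : W ⟶ AlgebraicGeometry.AffineSpace (Fin s) Y) (w : W), let M : Matrix (Fin 3) (Fin 3 ⊕ Fin m) (MvPolynomial (Fin 3 × Fin m) (ZMod p)) := Matrix.fromCols 1 (Matrix.of fun i j => MvPolynomial.X (i, j)); let I : Ideal (MvPolynomial (Fin 3 × Fin m) (ZMod p)) := Ideal.span ((fun u : Fin 3 → Fin 3 ⊕ Fin m => (M.submatrix id u).det) '' Γ0); ∃ i : W ⟶ AlgebraicGeometry.Spec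 (.of (Localization.Away (Ideal.Quotient.mk I (∏ u ∈ Γp, (M.submatrix id u).det)))), AlgebraicGeometry.IsOpenImmersion j ∧ AlgebraicGeometry.IsOpenImmersion i ∧ AlgebraicGeometry.IsIntegral W ∧ (CategoryTheory.over (AlgebraicGeometry.AffineSpace (Fin s) Y) Y).base (j.base w) = y) := by
  intro h
  let K : Type := RatFunc (ZMod 2)
  let Y : Scheme.{0} := Spec (.of K)
  let f : Y ⟶ Spec (.of (ZMod 2)) := Spec.map (CommRingCat.ofHom (algebraMap (ZMod 2) K))
  obtain ⟨y⟩ : Nonempty (PrimeSpectrum K) := inferInstance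
  obtain ⟨m, Γp, Γ0, s, W, j, w, i, hj, hi, hW, hwy⟩ :=
    h 2 Nat.prime_two Y f inferInstance inferInstance inferInstance y
  exact false_of_isOpenImmersion_affineSpace_ratFunc s j i w

end Summit.ResolutionOfSingularities.ResolutionOfSingularities.Theorems.Universality.Negative

end
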